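import Summits.QuantumFields.YangMills.Theorems.BalabanUVNodesN15TwoGridGluingAdjointGeneralTransport
import Summits.QuantumFields.YangMills.Theorems.BalabanUVNodesN15CurvedGluingLocalGaugesTwoGridTwisted
import Summits.QuantumFields.YangMills.Theorems.BalabanUVNodesN15TwoSpacingGluingAdjointLocalGauges
import HarnessLib

/-!
# N15 = NE2, road (c) — PROGRAMME (PC), (PC-E-K) ENTRY 2 OF (3.42) (THE ADJOINT ARRANGEMENT): THE TWO-GRID ADJOINT GLUE IN PER-CUBE GAUGES THROUGH THE TWISTED TRANSPORT — dag-n15-w2's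
# `…TwoSpacingGluingAdjointLocalGaugesTwoGridFit.hasMaj_idef_gluedL_comp_of_localGauges_fit` with the flat pull-back replaced by `T = M_{W′_□ᵀ}(M_{S_□ᵀ}∘pull)M_{W′_□∘σ}` (fine gauge
# `W′_□`, INDUCED coarse gauge `W′_□∘σ`, staircase field `S_□`), NO gauge fit: the adjoint per-piece conversions (n15-c∕333 §2 applied to OUTPUT-localized commutator pieces and to
# two-sided pieces) + the transport-generic adjoint glue n15-c∕423 (dag-n15-c g36, n15-c∕424)

Cell `pub-ymgap`, seat `pub-ymgap-dag-n15-c` (generation g36; R134 (a) seat, strategy s1 «first missing estimate»; HUMAN RULING D-0062; chair R424 venue).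
`bears_on: R4∕N15 · K3⁸ SpineGivenEndpointR13SepCoPHV (stmt-QuantumFields-27366)`; filed `--kind proof --supports stmt-QuantumFields-27366 --as helper` — COUNT-NEUTRAL.
THREE theorems + one [folklore] identity, 0 `def`, 0 `sorry`; bookkeeping over landed rows, NO new estimate.  Imports BY NAME n15-c∕423 `…TwoGridGluingAdjointGeneralTransport` (★★★★
`hasMaj_idef_glueInvL_parametrix_comp_cut_of_defect_out_tr`), n15-c∕333 `…CurvedGluingLocalGaugesTwoGridTwisted` (★★★ `hasMaj_idef_conj_tr`, `cutDefect_of_localGauge_tr`,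
`hasMaj_idef_mulOp_tr`), dag-n15-w2's n15-c FILE 160 `…TwoSpacingGluingAdjointLocalGauges` (`commRowR_of_localGauge`, `sandwichR_of_localGauge`, `sandwichRow_of_localGauge`,
`defectRow₂_of_localGauge`; through it `…CurvedGluingLocalGauges.cutRow_of_localGauge`, `…CubeDressedGeneralGauge.comp_commOp_gaugeConj`, `transpose_gaugeConj_cancel`).  Nothing in the
tree is modified, no landed name re-declared.

WHY.  n15-c∕423 is the entry-2 keystone through a general transport `τ`; as n15-c∕333 did for entries 0 (and, via 401∕402, entry 1), THIS FILE supplies the GAUGE LAYER: each cube's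
adjoint-side data live in the cube's own gauge pair, the transport factors per cube as `M_{W′_□ᵀ}∘(M_{S_□ᵀ}∘pull)∘M_{W′_□∘σ}`, and 333's per-piece conversion turns the FLAT cube-gauge
defects into `T`-defects of the conjugated-back pieces at the cost of the SMEARED stair letters `s` on the pieces' supports.  The adjoint side has two new piece types: the
OUTPUT-localized commutator pieces `G_□∘[Δ, M_{h_□}]` (§1 ★★ `commDefectR_of_localGauge_tr`: their fine INPUT support is displayed, the coarse OUTPUT support comes from the cube) and
the two-sided localized pieces (sandwiched right entries `T₂,□`, right-locality defects `Ẽ_□`; §1 ★★ `conjDefect₂_of_localGauge_tr`).  §2 assembles ★★★★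
`hasMaj_idef_gluedL_comp_of_localGauges_tr` = 164's theorem with `pull ↦ T`, induced coarse gauges, NO gauge fit, at the cost `m ↦ m + 2sβ`, `m₂ ↦ m₂ + 2sβ₂`, `r ↦ r + 2sθ₀`,
`r_E ↦ r_E + 2sε`, `o, o_s, o_d ↦ |κ|·` in the constants.  The cube level (dag-n15-c g18∕g19's adjoint capstone 165∕169 with TRUE right-locality defects, through `T`) and the site ∕
summand ∕ pairing ∕ named levels for entry 2 of THE scalar covariant Green's function follow the landed pattern 404–422.

HONEST FRAMING ∕ LIMITS.  Bookkeeping over landed rows; all piece rows, flat defects, support identities, sandwiches, Leibniz data and stair letters are HYPOTHESES; no pairing between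
the two grids' fields is assumed here; MODEL carriers; [Balaban1984PropagatorsII] (2.91)–(2.93) p.239, (2.133)–(2.136) p.247, [Balaban1985BackgroundPropagators] (3.34)–(3.35) p.396,
(3.42) p.397, Thm 3.14 pp.426–427, [King1986] p.664 = MECHANISM ∕ TEMPLATE, nothing printed is asserted.  NE2⁺ NOT PRINTED, NOT proved; N15 of record untouched (DISCHARGED AS
CONSUMED, p687738); K3⁸ OPEN; counts of record UNMOVED (typed 28∕28 · discharged 8∕27); one finite 𝕋⁴ at fixed ε per index — NOT infinite volume, NOT OS on ℝ⁴, NOT a mass gap, NOT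
Clay.  Restate-immune (no Theses import).
-/

set_option autoImplicit false

noncomputable section
open scoped BigOperators Matrix
open Finset

namespace Summit.QuantumFields.YangMills.BalabanUVNodes.N15.Gluing

open Literature.MathematicalPhysics.QuantumFieldTheory.Balaban1983to89
open Literature.MathematicalPhysics.QuantumFieldTheory.Balaban1983to89.B11SectG (BlockNorm HasMaj RowSum)
open Literature.MathematicalPhysics.QuantumFieldTheory.Balaban1983to89.B6RandomWalk (Triangle254)
open Literature.MathematicalPhysics.QuantumFieldTheory.Balaban1983to89.T4EtaRateDefect (idef)
open Literature.MathematicalPhysics.QuantumFieldTheory.Balaban1983to89.T4EtaRateCoeffDefect (pull)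
open Literature.MathematicalPhysics.QuantumFieldTheory.Balaban1983to89.B6Prop26Gluing (mulOp ind ind_nonneg)
open Summit.QuantumFields.YangMills.BalabanUVNodes.N15.MatrixSpecies (mmulOp liftBlk liftMap)
open Summit.QuantumFields.YangMills.BalabanUVNodes.N15.CurvedSpecies (cutRow_of_localGauge comp_commOp_gaugeConj transpose_gaugeConj_cancel hasMaj_idef_conj_tr
  cutDefect_of_localGauge_tr hasMaj_idef_mulOp_tr)

/-! ## §1 The two adjoint piece types, twisted -/

section Pieces

variable {X X' κ K : Type} [Fintype X] [Fintype X'] [Fintype κ] [DecidableEq κ] {g : B6.Geometry}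
  (blk : X → g.Site) (π : X' → X) (sec : X → X') (S : K → Set g.Site) (T : (X × κ → ℝ) →ₗ[ℝ] (X' × κ → ℝ)) (W' St : K → X' → Matrix κ κ ℝ)
  {Δ : (X × κ → ℝ) →ₗ[ℝ] (X × κ → ℝ)} {Δ' : (X' × κ → ℝ) →ₗ[ℝ] (X' × κ → ℝ)} {G' Y' : K → (X × κ → ℝ) →ₗ[ℝ] (X × κ → ℝ)}
  {G'' Y'' : K → (X' × κ → ℝ) →ₗ[ℝ] (X' × κ → ℝ)} {hX ψout : K → X → ℝ} {hX' ψin' : K → X' → ℝ}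

omit [Fintype X] [Fintype κ] [DecidableEq κ] in
/-- An output cut `M_ψ` fixing `G` also fixes `M_χ∘G` (site multipliers commute). [folklore] -/
theorem mulOp_comp_cut_of_outputSupport {ψ χ : X → ℝ} {G : (X × κ → ℝ) →ₗ[ℝ] (X × κ → ℝ)} (h : mulOp (fun p : X × κ => ψ p.1) ∘ₗ G = G) :
    mulOp (fun p : X × κ => ψ p.1) ∘ₗ (mulOp (fun p : X × κ => χ p.1) ∘ₗ G) = mulOp (fun p : X × κ => χ p.1) ∘ₗ G := by
  rw [← LinearMap.comp_assoc, mulOp_comp_mulOp, show ((fun p : X × κ => ψ p.1) * fun p : X × κ => χ p.1) = ((fun p : X × κ => χ p.1) * fun p : X × κ => ψ p.1) from mul_comm _ _,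
    ← mulOp_comp_mulOp, LinearMap.comp_assoc, h]

/-- ★★ **ADJOINT COMMUTATOR-PIECE DEFECTS, TWISTED**: the cube-gauge OUTPUT-localized adjoint commutator pieces `G′_□∘[Δ^{W′σ}, M_h]`, `G″_□∘[Δ′^{W′}, M_{h′}]` (rows `1_S(y)θ₀e^{−δd}`),
their flat defect `1_S(y)re^{−δd}`, the fine piece's INPUT support `ψ′_in` (displayed), the coarse cube's output support `ψ_out`, and the SMEARED stair letters `s` on those supports ⟹
`𝔇_T((M_{W′ᵀ}G″M_{W′})∘[Δ′, M_{h′}], (M_{(W′σ)ᵀ}G′M_{W′σ})∘[Δ, M_h]) ≤ 1_S(y)·|κ|²(r + 2sθ₀)·e^{−δd}` (the conjugation identity is dag-n15-w3's `comp_commOp_gaugeConj`).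
[cite: Balaban1984PropagatorsII, (2.93) p.239 (shape, transposed); Balaban1985BackgroundPropagators, (3.34) p.396, Thm 3.14 pp.426–427 (difference template)] -/
theorem commDefectR_of_localGauge_tr (hW'1 : ∀ k v, (W' k v)ᵀ * W' k v = 1) (hW'2 : ∀ k v, W' k v * (W' k v)ᵀ = 1) {θ₀ r s δ : ℝ} (hθ : 0 ≤ θ₀) (hr : 0 ≤ r) (hs : 0 ≤ s) (k : K)
    (hTk : T = mmulOp (fun x' => (W' k x')ᵀ) ∘ₗ (mmulOp (fun x' => (St k x')ᵀ) ∘ₗ pull (liftMap π κ)) ∘ₗ mmulOp (fun x => W' k (sec x)))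
    (hKin' : (G'' k ∘ₗ commOp (mmulOp (W' k) ∘ₗ Δ' ∘ₗ mmulOp (fun x' => (W' k x')ᵀ)) (fun p : X' × κ => hX' k p.1)) ∘ₗ mulOp (fun p : X' × κ => ψin' k p.1) =
      G'' k ∘ₗ commOp (mmulOp (W' k) ∘ₗ Δ' ∘ₗ mmulOp (fun x' => (W' k x')ᵀ)) (fun p : X' × κ => hX' k p.1))
    (hGout : mulOp (fun p : X × κ => ψout k p.1) ∘ₗ G' k = G' k)
    (hSin : ∀ x' i, ∑ j, |(ψin' k x' • ((St k x')ᵀ - 1)) i j| ≤ s) (hSout : ∀ x' i, ∑ j, |(ψout k (π x') • ((St k x')ᵀ - 1)) i j| ≤ s)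
    (hK : HasMaj (BlockNorm.ofBlocks g (liftBlk blk κ)) (BlockNorm.ofBlocks g (liftBlk blk κ)) (G' k ∘ₗ commOp (mmulOp (fun x => W' k (sec x)) ∘ₗ Δ ∘ₗ mmulOp (fun x => (W' k (sec x))ᵀ)) (fun p : X × κ => hX k p.1))
      (fun y y' => ind (S k) y * (θ₀ * Real.exp (-(δ * g.dist y y')))))
    (hK' : HasMaj (BlockNorm.ofBlocks g (liftBlk (blk ∘ π) κ)) (BlockNorm.ofBlocks g (liftBlk (blk ∘ π) κ)) (G'' k ∘ₗ commOp (mmulOp (W' k) ∘ₗ Δ' ∘ₗ mmulOp (fun x' => (W' k x')ᵀ)) (fun p : X' × κ => hX' k p.1))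
      (fun y y' => ind (S k) y * (θ₀ * Real.exp (-(δ * g.dist y y')))))
    (hD : HasMaj (BlockNorm.ofBlocks g (liftBlk blk κ)) (BlockNorm.ofBlocks g (liftBlk (blk ∘ π) κ))
      (idef (pull (liftMap π κ)) (pull (liftMap π κ)) (G'' k ∘ₗ commOp (mmulOp (W' k) ∘ₗ Δ' ∘ₗ mmulOp (fun x' => (W' k x')ᵀ)) (fun p : X' × κ => hX' k p.1)) (G' k ∘ₗ commOp (mmulOp (fun x => W' k (sec x)) ∘ₗ Δ ∘ₗ mmulOp (fun x => (W' k (sec x))ᵀ)) (fun p : X × κ => hX k p.1)))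
      (fun y y' => ind (S k) y * (r * Real.exp (-(δ * g.dist y y'))))) :
    HasMaj (BlockNorm.ofBlocks g (liftBlk blk κ)) (BlockNorm.ofBlocks g (liftBlk (blk ∘ π) κ))
      (idef T T ((mmulOp (fun x' => (W' k x')ᵀ) ∘ₗ G'' k ∘ₗ mmulOp (W' k)) ∘ₗ commOp Δ' (fun p : X' × κ => hX' k p.1)) ((mmulOp (fun x => (W' k (sec x))ᵀ) ∘ₗ G' k ∘ₗ mmulOp (fun x => W' k (sec x))) ∘ₗ commOp Δ (fun p : X × κ => hX k p.1)))
      (fun y y' => ind (S k) y * ((Fintype.card κ : ℝ) ^ 2 * (r + s * θ₀ + s * θ₀) * Real.exp (-(δ * g.dist y y')))) := by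
  have hV' : ∀ x, ((W' k (sec x))ᵀ)ᵀ * (W' k (sec x))ᵀ = 1 := fun x => by rw [Matrix.transpose_transpose]; exact hW'2 k (sec x)
  have hV'' : ∀ x', ((W' k x')ᵀ)ᵀ * (W' k x')ᵀ = 1 := fun x' => by rw [Matrix.transpose_transpose]; exact hW'2 k x'
  have e := comp_commOp_gaugeConj (fun x => (W' k (sec x))ᵀ) hV' (hX k) (mmulOp (fun x => W' k (sec x)) ∘ₗ Δ ∘ₗ mmulOp (fun x => (W' k (sec x))ᵀ)) (G' k)
  have e' := comp_commOp_gaugeConj (fun x' => (W' k x')ᵀ) hV'' (hX' k) (mmulOp (W' k) ∘ₗ Δ' ∘ₗ mmulOp (fun x' => (W' k x')ᵀ)) (G'' k)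
  simp only [Matrix.transpose_transpose] at e e'
  rw [transpose_gaugeConj_cancel (fun x => W' k (sec x)) (fun x => hW'1 k (sec x)) Δ] at e
  rw [show (fun x' => W' k x') = W' k from rfl, transpose_gaugeConj_cancel (W' k) (hW'1 k) Δ'] at e'
  rw [e, e']
  have hYout : mulOp (fun p : X × κ => ψout k p.1) ∘ₗ (G' k ∘ₗ commOp (mmulOp (fun x => W' k (sec x)) ∘ₗ Δ ∘ₗ mmulOp (fun x => (W' k (sec x))ᵀ)) (fun p : X × κ => hX k p.1)) =
      G' k ∘ₗ commOp (mmulOp (fun x => W' k (sec x)) ∘ₗ Δ ∘ₗ mmulOp (fun x => (W' k (sec x))ᵀ)) (fun p : X × κ => hX k p.1) := by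
    rw [← LinearMap.comp_assoc, hGout]
  have hE : ∀ y y' : g.Site, 0 ≤ Real.exp (-(δ * g.dist y y')) := fun _ _ => Real.exp_nonneg _
  have h := hasMaj_idef_conj_tr blk π sec T (W' k) (St k) (hW'1 k) (hW'2 k) hTk hs hKin' hYout hSin hSout
    (fun a b => mul_nonneg (ind_nonneg _ a) (mul_nonneg hθ (hE a b))) (fun a b => mul_nonneg (ind_nonneg _ a) (mul_nonneg hθ (hE a b)))
    (fun a b => mul_nonneg (ind_nonneg _ a) (mul_nonneg hr (hE a b))) hK' hK hD
  exact h.mono fun y y' => le_of_eq (by ring)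

/-- ★★ **TWO-SIDED PIECE DEFECTS, TWISTED** (sandwiched right entries `T₂,□`, right-locality defects `Ẽ_□`): cube-gauge rows `1_S1_S·βe^{−δd}` on both grids, flat defect
`1_S1_S·me^{−δd}`, fine input support `ψ′_in`, coarse output support `ψ_out`, smeared stair letters `s` ⟹ `𝔇_T(M_{W′ᵀ}Y″M_{W′}, M_{(W′σ)ᵀ}Y′M_{W′σ}) ≤ 1_S1_S·|κ|²(m + 2sβ)·e^{−δd}`.
[cite: Balaban1985BackgroundPropagators, (3.34)–(3.35) p.396, Thm 3.14 pp.426–427 (shape); Balaban1984PropagatorsII, (2.133)–(2.135) p.247] -/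
theorem conjDefect₂_of_localGauge_tr (hW'1 : ∀ k v, (W' k v)ᵀ * W' k v = 1) (hW'2 : ∀ k v, W' k v * (W' k v)ᵀ = 1) {β m s δ : ℝ} (hβ : 0 ≤ β) (hm : 0 ≤ m) (hs : 0 ≤ s) (k : K)
    (hTk : T = mmulOp (fun x' => (W' k x')ᵀ) ∘ₗ (mmulOp (fun x' => (St k x')ᵀ) ∘ₗ pull (liftMap π κ)) ∘ₗ mmulOp (fun x => W' k (sec x)))
    (hYin' : Y'' k ∘ₗ mulOp (fun p : X' × κ => ψin' k p.1) = Y'' k) (hYout : mulOp (fun p : X × κ => ψout k p.1) ∘ₗ Y' k = Y' k)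
    (hSin : ∀ x' i, ∑ j, |(ψin' k x' • ((St k x')ᵀ - 1)) i j| ≤ s) (hSout : ∀ x' i, ∑ j, |(ψout k (π x') • ((St k x')ᵀ - 1)) i j| ≤ s)
    (hY : HasMaj (BlockNorm.ofBlocks g (liftBlk blk κ)) (BlockNorm.ofBlocks g (liftBlk blk κ)) (Y' k) (fun y y' => ind (S k) y * ind (S k) y' * (β * Real.exp (-(δ * g.dist y y')))))
    (hY' : HasMaj (BlockNorm.ofBlocks g (liftBlk (blk ∘ π) κ)) (BlockNorm.ofBlocks g (liftBlk (blk ∘ π) κ)) (Y'' k) (fun y y' => ind (S k) y * ind (S k) y' * (β * Real.exp (-(δ * g.dist y y')))))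
    (hD : HasMaj (BlockNorm.ofBlocks g (liftBlk blk κ)) (BlockNorm.ofBlocks g (liftBlk (blk ∘ π) κ)) (idef (pull (liftMap π κ)) (pull (liftMap π κ)) (Y'' k) (Y' k))
      (fun y y' => ind (S k) y * ind (S k) y' * (m * Real.exp (-(δ * g.dist y y'))))) :
    HasMaj (BlockNorm.ofBlocks g (liftBlk blk κ)) (BlockNorm.ofBlocks g (liftBlk (blk ∘ π) κ))
      (idef T T (mmulOp (fun x' => (W' k x')ᵀ) ∘ₗ Y'' k ∘ₗ mmulOp (W' k)) (mmulOp (fun x => (W' k (sec x))ᵀ) ∘ₗ Y' k ∘ₗ mmulOp (fun x => W' k (sec x))))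
      (fun y y' => ind (S k) y * ind (S k) y' * ((Fintype.card κ : ℝ) ^ 2 * (m + s * β + s * β) * Real.exp (-(δ * g.dist y y')))) := by
  have hE : ∀ y y' : g.Site, 0 ≤ Real.exp (-(δ * g.dist y y')) := fun _ _ => Real.exp_nonneg _
  have h := hasMaj_idef_conj_tr blk π sec T (W' k) (St k) (hW'1 k) (hW'2 k) hTk hs hYin' hYout hSin hSout
    (fun a b => mul_nonneg (mul_nonneg (ind_nonneg _ a) (ind_nonneg _ b)) (mul_nonneg hβ (hE a b)))
    (fun a b => mul_nonneg (mul_nonneg (ind_nonneg _ a) (ind_nonneg _ b)) (mul_nonneg hβ (hE a b)))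
    (fun a b => mul_nonneg (mul_nonneg (ind_nonneg _ a) (ind_nonneg _ b)) (mul_nonneg hm (hE a b))) hY' hY hD
  exact h.mono fun y y' => le_of_eq (by ring)

end Pieces

/-! ## §2 The two-grid adjoint glue in per-cube gauges through the twisted transport -/

section Glue

variable {X X' κ K : Type} [Fintype X] [Fintype X'] [DecidableEq X] [DecidableEq X'] [Fintype κ] [DecidableEq κ] [Fintype K] {g : B6.Geometry}
  (blk : X → g.Site) (π : X' → X) (sec : X → X') (S : K → Set g.Site) {σ cr : ℝ} (T : (X × κ → ℝ) →ₗ[ℝ] (X' × κ → ℝ)) (W' St : K → X' → Matrix κ κ ℝ) (Ψ : X' → Matrix κ κ ℝ)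
  {Δ E : (X × κ → ℝ) →ₗ[ℝ] (X × κ → ℝ)} {Δ' Ef : (X' × κ → ℝ) →ₗ[ℝ] (X' × κ → ℝ)} {G' T' E' : K → (X × κ → ℝ) →ₗ[ℝ] (X × κ → ℝ)}
  {G'' T'' E'' : K → (X' × κ → ℝ) →ₗ[ℝ] (X' × κ → ℝ)} {χX hX hs dh ψout : K → X → ℝ} {χX' hX' hs' dh' ψin' : K → X' → ℝ}

/-- ★★★★ **THE TWO-GRID η-DEFECT OF ENTRY 2 OF THE ADJOINT GLUED OPERATOR, EACH CUBE IN ITS OWN GAUGE PAIR, THROUGH THE TWISTED TRANSPORT — NO GAUGE FIT** (n15-c FILE 164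
`hasMaj_idef_gluedL_comp_of_localGauges_fit` with `pull ↦ T`, fine gauges `W′_□`, induced coarse gauges `W′_□∘σ`; n15-c∕423 ★★★★ fed by §1, n15-c∕333 §3 and FILE 160's transfers):
right factors `E` (coarse), `E_f` (fine) with scalar adjoint Leibniz rules through the partitions; per cube `k`, IN THE CUBE's GAUGES: cut rows, sandwiched right entries `T′_□`∕`T″_□`
against the conjugated right factors, OUTPUT-localized adjoint commutator rows, two-sided right-locality defect rows, their FLAT two-grid defects, supports and smeared stair letters;
the flat partition fits `o, o_s, o_d`; the transport's per-cube factorization and global product form ⟹ n15-c∕423's bound with `β, β₂, θ₀, ε ↦ |κ|²·`, `m₀ ↦ |κ|²(m + 2sβ)`,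
`m₂ ↦ |κ|²(m₂ + 2sβ₂)`, `r ↦ |κ|²(r + 2sθ₀)`, `r_E ↦ |κ|²(r_E + 2sε)`, `o, o_s, o_d ↦ |κ|·`. [cite: Balaban1985BackgroundPropagators, Thm 3.14 pp.426–427 (difference template), (3.34)–(3.35) p.396, (3.42) p.397,
(3.87)–(3.90) pp.409–410; Balaban1984PropagatorsII, (2.91)–(2.93) p.239, (2.133)–(2.136) p.247; King1986, p.664 (pairing)] -/
theorem hasMaj_idef_gluedL_comp_of_localGauges_tr (htri : Triangle254 g) (hd : ∀ a b : g.Site, 0 ≤ g.dist a b) (hd0 : ∀ y : g.Site, g.dist y y = 0) (hrow : RowSum g σ cr)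
    (hσ : 0 ≤ σ) (hcr : 0 ≤ cr) (hW'1 : ∀ k v, (W' k v)ᵀ * W' k v = 1) (hW'2 : ∀ k v, W' k v * (W' k v)ᵀ = 1)
    {β β₂ cs cd o os od m m₂ θ₀ ε r rE s δ Nov : ℝ} (hβ : 0 ≤ β) (hβ₂ : 0 ≤ β₂) (hcs : 0 ≤ cs) (hcd : 0 ≤ cd) (ho : 0 ≤ o) (hos : 0 ≤ os) (hod : 0 ≤ od) (hm : 0 ≤ m) (hm₂ : 0 ≤ m₂)
    (hθ : 0 ≤ θ₀) (hε : 0 ≤ ε) (hr : 0 ≤ r) (hrE : 0 ≤ rE) (hs0 : 0 ≤ s) (hNov : 0 ≤ Nov) (hσδ : 2 * σ ≤ δ)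
    -- the transport: per-cube factorization through the cube's gauge pair and stair field, and its global product form
    (hTk : ∀ k, T = mmulOp (fun x' => (W' k x')ᵀ) ∘ₗ (mmulOp (fun x' => (St k x')ᵀ) ∘ₗ pull (liftMap π κ)) ∘ₗ mmulOp (fun x => W' k (sec x)))
    (hT0 : T = mmulOp (fun x' => (Ψ x')ᵀ) ∘ₗ pull (liftMap π κ)) (hΨ : ∀ x' i j, |(Ψ x')ᵀ i j| ≤ 1)
    -- the right factors' scalar adjoint Leibniz rules through the partitions, the cuts, the flat partition fits
    (hleib : ∀ k, mulOp (fun p : X × κ => hX k p.1) ∘ₗ E = E ∘ₗ mulOp (fun p : X × κ => hs k p.1) + mulOp (fun p : X × κ => dh k p.1))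
    (hleib' : ∀ k, mulOp (fun p : X' × κ => hX' k p.1) ∘ₗ Ef = Ef ∘ₗ mulOp (fun p : X' × κ => hs' k p.1) + mulOp (fun p : X' × κ => dh' k p.1))
    (hcut : ∀ k, mulOp (fun p : X × κ => hX k p.1) ∘ₗ mulOp (fun p : X × κ => χX k p.1) = mulOp (fun p : X × κ => hX k p.1))
    (hcut' : ∀ k, mulOp (fun p : X' × κ => hX' k p.1) ∘ₗ mulOp (fun p : X' × κ => χX' k p.1) = mulOp (fun p : X' × κ => hX' k p.1))
    (hh : ∀ k x, |hX k x| ≤ 1) (hh' : ∀ k x', |hX' k x'| ≤ 1) (hhs : ∀ k x, |hs k x| ≤ cs) (hdh : ∀ k x, |dh k x| ≤ cd)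
    (hfit : ∀ k p, |(fun p : X' × κ => hX' k p.1) p - (fun p : X × κ => hX k p.1) (liftMap π κ p)| ≤ o)
    (hfits : ∀ k p, |(fun p : X' × κ => hs' k p.1) p - (fun p : X × κ => hs k p.1) (liftMap π κ p)| ≤ os)
    (hfitd : ∀ k p, |(fun p : X' × κ => dh' k p.1) p - (fun p : X × κ => dh k p.1) (liftMap π κ p)| ≤ od)
    (hN : ∀ a, ∑ k, ind (S k) a ≤ Nov)
    -- the sandwiches of the cubes against the conjugated right factors, in the cubes' gauges
    (hE2 : ∀ k, mulOp (fun p : X × κ => χX k p.1) ∘ₗ G' k ∘ₗ (mmulOp (fun x => W' k (sec x)) ∘ₗ E ∘ₗ mmulOp (fun x => (W' k (sec x))ᵀ)) ∘ₗ mulOp (fun p : X × κ => hs k p.1) = T' k ∘ₗ mulOp (fun p : X × κ => hs k p.1))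
    (hE2' : ∀ k, mulOp (fun p : X' × κ => χX' k p.1) ∘ₗ G'' k ∘ₗ (mmulOp (W' k) ∘ₗ Ef ∘ₗ mmulOp (fun x' => (W' k x')ᵀ)) ∘ₗ mulOp (fun p : X' × κ => hs' k p.1) = T'' k ∘ₗ mulOp (fun p : X' × κ => hs' k p.1))
    -- supports of the pieces (fine input, coarse output) and the SMEARED stair letters on them
    (hGin' : ∀ k, G'' k ∘ₗ mulOp (fun p : X' × κ => ψin' k p.1) = G'' k) (hTin' : ∀ k, T'' k ∘ₗ mulOp (fun p : X' × κ => ψin' k p.1) = T'' k)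
    (hEin' : ∀ k, E'' k ∘ₗ mulOp (fun p : X' × κ => ψin' k p.1) = E'' k)
    (hKin' : ∀ k, (G'' k ∘ₗ commOp (mmulOp (W' k) ∘ₗ Δ' ∘ₗ mmulOp (fun x' => (W' k x')ᵀ)) (fun p : X' × κ => hX' k p.1)) ∘ₗ mulOp (fun p : X' × κ => ψin' k p.1) = G'' k ∘ₗ commOp (mmulOp (W' k) ∘ₗ Δ' ∘ₗ mmulOp (fun x' => (W' k x')ᵀ)) (fun p : X' × κ => hX' k p.1))
    (hGout : ∀ k, mulOp (fun p : X × κ => ψout k p.1) ∘ₗ G' k = G' k) (hTout : ∀ k, mulOp (fun p : X × κ => ψout k p.1) ∘ₗ T' k = T' k)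
    (hEout : ∀ k, mulOp (fun p : X × κ => ψout k p.1) ∘ₗ E' k = E' k)
    (hSin : ∀ k x' i, ∑ j, |(ψin' k x' • ((St k x')ᵀ - 1)) i j| ≤ s) (hSout : ∀ k x' i, ∑ j, |(ψout k (π x') • ((St k x')ᵀ - 1)) i j| ≤ s)
    -- rows in the cubes' gauges, both grids
    (hGc : ∀ k, HasMaj (BlockNorm.ofBlocks g (liftBlk blk κ)) (BlockNorm.ofBlocks g (liftBlk blk κ)) (mulOp (fun p : X × κ => χX k p.1) ∘ₗ G' k)
      (fun y y' => ind (S k) y * ind (S k) y' * (β * Real.exp (-(δ * g.dist y y')))))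
    (hGc' : ∀ k, HasMaj (BlockNorm.ofBlocks g (liftBlk (blk ∘ π) κ)) (BlockNorm.ofBlocks g (liftBlk (blk ∘ π) κ)) (mulOp (fun p : X' × κ => χX' k p.1) ∘ₗ G'' k)
      (fun y y' => ind (S k) y * ind (S k) y' * (β * Real.exp (-(δ * g.dist y y')))))
    (hT' : ∀ k, HasMaj (BlockNorm.ofBlocks g (liftBlk blk κ)) (BlockNorm.ofBlocks g (liftBlk blk κ)) (T' k) (fun y y' => ind (S k) y * ind (S k) y' * (β₂ * Real.exp (-(δ * g.dist y y')))))
    (hT'' : ∀ k, HasMaj (BlockNorm.ofBlocks g (liftBlk (blk ∘ π) κ)) (BlockNorm.ofBlocks g (liftBlk (blk ∘ π) κ)) (T'' k) (fun y y' => ind (S k) y * ind (S k) y' * (β₂ * Real.exp (-(δ * g.dist y y')))))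
    (hK : ∀ k, HasMaj (BlockNorm.ofBlocks g (liftBlk blk κ)) (BlockNorm.ofBlocks g (liftBlk blk κ)) (G' k ∘ₗ commOp (mmulOp (fun x => W' k (sec x)) ∘ₗ Δ ∘ₗ mmulOp (fun x => (W' k (sec x))ᵀ)) (fun p : X × κ => hX k p.1))
      (fun y y' => ind (S k) y * (θ₀ * Real.exp (-(δ * g.dist y y')))))
    (hK' : ∀ k, HasMaj (BlockNorm.ofBlocks g (liftBlk (blk ∘ π) κ)) (BlockNorm.ofBlocks g (liftBlk (blk ∘ π) κ)) (G'' k ∘ₗ commOp (mmulOp (W' k) ∘ₗ Δ' ∘ₗ mmulOp (fun x' => (W' k x')ᵀ)) (fun p : X' × κ => hX' k p.1))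
      (fun y y' => ind (S k) y * (θ₀ * Real.exp (-(δ * g.dist y y')))))
    (hEd : ∀ k, HasMaj (BlockNorm.ofBlocks g (liftBlk blk κ)) (BlockNorm.ofBlocks g (liftBlk blk κ)) (E' k) (fun y y' => ind (S k) y * ind (S k) y' * (ε * Real.exp (-(δ * g.dist y y')))))
    (hEd' : ∀ k, HasMaj (BlockNorm.ofBlocks g (liftBlk (blk ∘ π) κ)) (BlockNorm.ofBlocks g (liftBlk (blk ∘ π) κ)) (E'' k) (fun y y' => ind (S k) y * ind (S k) y' * (ε * Real.exp (-(δ * g.dist y y')))))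
    -- FLAT η-defects in the cubes' gauges
    (hDGc : ∀ k, HasMaj (BlockNorm.ofBlocks g (liftBlk blk κ)) (BlockNorm.ofBlocks g (liftBlk (blk ∘ π) κ))
      (idef (pull (liftMap π κ)) (pull (liftMap π κ)) (mulOp (fun p : X' × κ => χX' k p.1) ∘ₗ G'' k) (mulOp (fun p : X × κ => χX k p.1) ∘ₗ G' k))
      (fun y y' => ind (S k) y * ind (S k) y' * (m * Real.exp (-(δ * g.dist y y')))))
    (hDT : ∀ k, HasMaj (BlockNorm.ofBlocks g (liftBlk blk κ)) (BlockNorm.ofBlocks g (liftBlk (blk ∘ π) κ)) (idef (pull (liftMap π κ)) (pull (liftMap π κ)) (T'' k) (T' k))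
      (fun y y' => ind (S k) y * ind (S k) y' * (m₂ * Real.exp (-(δ * g.dist y y')))))
    (hDK : ∀ k, HasMaj (BlockNorm.ofBlocks g (liftBlk blk κ)) (BlockNorm.ofBlocks g (liftBlk (blk ∘ π) κ))
      (idef (pull (liftMap π κ)) (pull (liftMap π κ)) (G'' k ∘ₗ commOp (mmulOp (W' k) ∘ₗ Δ' ∘ₗ mmulOp (fun x' => (W' k x')ᵀ)) (fun p : X' × κ => hX' k p.1)) (G' k ∘ₗ commOp (mmulOp (fun x => W' k (sec x)) ∘ₗ Δ ∘ₗ mmulOp (fun x => (W' k (sec x))ᵀ)) (fun p : X × κ => hX k p.1)))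
      (fun y y' => ind (S k) y * (r * Real.exp (-(δ * g.dist y y')))))
    (hDE : ∀ k, HasMaj (BlockNorm.ofBlocks g (liftBlk blk κ)) (BlockNorm.ofBlocks g (liftBlk (blk ∘ π) κ)) (idef (pull (liftMap π κ)) (pull (liftMap π κ)) (E'' k) (E' k))
      (fun y y' => ind (S k) y * ind (S k) y' * (rE * Real.exp (-(δ * g.dist y y')))))
    (hq : Nov * ((Fintype.card κ : ℝ) ^ 2 * θ₀ + (Fintype.card κ : ℝ) ^ 2 * ε) * cr < 1) :
    HasMaj (BlockNorm.ofBlocks g (liftBlk blk κ)) (BlockNorm.ofBlocks g (liftBlk (blk ∘ π) κ))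
      (idef T T
        (glueInvL (remainderL Δ' (fun k => fun p : X' × κ => hX' k p.1) (fun k => (mmulOp (fun x' => (W' k x')ᵀ) ∘ₗ G'' k ∘ₗ mmulOp (W' k))) - ∑ k, mulOp (fun p : X' × κ => hX' k p.1) ∘ₗ (mmulOp (fun x' => (W' k x')ᵀ) ∘ₗ E'' k ∘ₗ mmulOp (W' k)))
          (parametrix (fun k => fun p : X' × κ => hX' k p.1) (fun k => (mmulOp (fun x' => (W' k x')ᵀ) ∘ₗ G'' k ∘ₗ mmulOp (W' k)))) ∘ₗ Ef)
        (glueInvL (remainderL Δ (fun k => fun p : X × κ => hX k p.1) (fun k => (mmulOp (fun x => (W' k (sec x))ᵀ) ∘ₗ G' k ∘ₗ mmulOp (fun x => W' k (sec x)))) - ∑ k, mulOp (fun p : X × κ => hX k p.1) ∘ₗ (mmulOp (fun x => (W' k (sec x))ᵀ) ∘ₗ E' k ∘ₗ mmulOp (fun x => W' k (sec x))))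
          (parametrix (fun k => fun p : X × κ => hX k p.1) (fun k => (mmulOp (fun x => (W' k (sec x))ᵀ) ∘ₗ G' k ∘ₗ mmulOp (fun x => W' k (sec x))))) ∘ₗ E))
      (fun y y' => ((1 - Nov * (((Fintype.card κ : ℝ) ^ 2 * θ₀) + ((Fintype.card κ : ℝ) ^ 2 * ε)) * cr)⁻¹ * (Nov * ((1 * ((Fintype.card κ : ℝ) ^ 2 * β₂) * ((Fintype.card κ : ℝ) * os) + 1 * ((Fintype.card κ : ℝ) ^ 2 * (m₂ + s * β₂ + s * β₂)) * cs + ((Fintype.card κ : ℝ) * o) * ((Fintype.card κ : ℝ) ^ 2 * β₂) * cs) + (1 * ((Fintype.card κ : ℝ) ^ 2 * β) * ((Fintype.card κ : ℝ) * od) + 1 * ((Fintype.card κ : ℝ) ^ 2 * (m + s * β + s * β)) * cd + ((Fintype.card κ : ℝ) * o) * ((Fintype.card κ : ℝ) ^ 2 * β) * cd))) * cr + (1 - Nov * (((Fintype.card κ : ℝ) ^ 2 * θ₀) + ((Fintype.card κ : ℝ) ^ 2 * ε)) * cr)⁻¹ * ((Nov * (((Fintype.card κ : ℝ) ^ 2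 * (r + s * θ₀ + s * θ₀)) + ((Fintype.card κ : ℝ) * o) * ((Fintype.card κ : ℝ) ^ 2 * θ₀) + (1 * ((Fintype.card κ : ℝ) ^ 2 * (rE + s * ε + s * ε)) + ((Fintype.card κ : ℝ) * o) * ((Fintype.card κ : ℝ) ^ 2 * ε)))) * ((1 - Nov * (((Fintype.card κ : ℝ) ^ 2 * θ₀) + ((Fintype.card κ : ℝ) ^ 2 * ε)) * cr)⁻¹ * (Nov * (((Fintype.card κ : ℝ) ^ 2 * β₂) * cs + ((Fintype.card κ : ℝ) ^ 2 * β) * cd)) * cr) * cr) * cr) *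
        Real.exp (-((δ - 2 * σ) * g.dist y y'))) := by
  have hK1 : 0 ≤ (Fintype.card κ : ℝ) := Nat.cast_nonneg _
  exact hasMaj_idef_glueInvL_parametrix_comp_cut_of_defect_out_tr (liftBlk blk κ) (liftMap π κ) S T htri hd hd0 hrow hσ hcr (by positivity) (by positivity) hcs hcd
    (by positivity) (by positivity) (by positivity) (by positivity) (by positivity) (by positivity) (by positivity) (by positivity) (by positivity) hNov hσδ hleib hleib' hcut hcut'
    (fun k => sandwichR_of_localGauge (fun k x => W' k (sec x)) E χX hs G' T' (fun k x => hW'1 k (sec x)) k (hE2 k))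
    (fun k => sandwichR_of_localGauge W' Ef χX' hs' G'' T'' hW'1 k (hE2' k))
    (fun k p => hh k p.1) (fun k p => hh' k p.1) (fun k p => hhs k p.1) (fun k p => hdh k p.1)
    (fun k => hasMaj_idef_mulOp_tr blk π T hT0 hΨ ho (hfit k)) (fun k => hasMaj_idef_mulOp_tr blk π T hT0 hΨ hos (hfits k)) (fun k => hasMaj_idef_mulOp_tr blk π T hT0 hΨ hod (hfitd k)) hN
    (fun k => cutRow_of_localGauge blk S (fun k x => W' k (sec x)) χX G' (fun k x => hW'2 k (sec x)) (fun k x => hW'1 k (sec x)) hβ k (hGc k))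
    (fun k => cutRow_of_localGauge (blk ∘ π) S W' χX' G'' hW'2 hW'1 hβ k (hGc' k))
    (fun k => sandwichRow_of_localGauge blk S (fun k x => W' k (sec x)) T' (fun k x => hW'2 k (sec x)) (fun k x => hW'1 k (sec x)) hβ₂ k (hT' k))
    (fun k => sandwichRow_of_localGauge (blk ∘ π) S W' T'' hW'2 hW'1 hβ₂ k (hT'' k))
    (fun k => cutDefect_of_localGauge_tr blk π sec S T W' St hW'1 hW'2 hβ hm hs0 k (hTk k) (hGin' k) (mulOp_comp_cut_of_outputSupport (hGout k)) (hSin k) (hSout k) (hGc k) (hGc' k) (hDGc k))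
    (fun k => conjDefect₂_of_localGauge_tr blk π sec S T W' St hW'1 hW'2 hβ₂ hm₂ hs0 k (hTk k) (hTin' k) (hTout k) (hSin k) (hSout k) (hT' k) (hT'' k) (hDT k))
    (fun k => commRowR_of_localGauge blk S (fun k x => W' k (sec x)) Δ hX G' (fun k x => hW'2 k (sec x)) (fun k x => hW'1 k (sec x)) hθ k (hK k))
    (fun k => commRowR_of_localGauge (blk ∘ π) S W' Δ' hX' G'' hW'2 hW'1 hθ k (hK' k))
    (fun k => commDefectR_of_localGauge_tr blk π sec S T W' St hW'1 hW'2 hθ hr hs0 k (hTk k) (hKin' k) (hGout k) (hSin k) (hSout k) (hK k) (hK' k) (hDK k))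
    (fun k => defectRow₂_of_localGauge blk S (fun k x => W' k (sec x)) E' (fun k x => hW'2 k (sec x)) (fun k x => hW'1 k (sec x)) hε k (hEd k))
    (fun k => defectRow₂_of_localGauge (blk ∘ π) S W' E'' hW'2 hW'1 hε k (hEd' k))
    (fun k => conjDefect₂_of_localGauge_tr blk π sec S T W' St hW'1 hW'2 hε hrE hs0 k (hTk k) (hEin' k) (hEout k) (hSin k) (hSout k) (hEd k) (hEd' k) (hDE k)) hq

end Glue

end Summit.QuantumFields.YangMills.BalabanUVNodes.N15.Gluing

end
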